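import Literature.NumberTheory.GaloisRepresentations.IdelicLocalNorm
import Literature.NumberTheory.Automorphic.IdeleClassCharacterConjugate
import HarnessLib

/-!
# Local components of the Galois conjugate of a Hecke character

Topic `NumberTheory/GaloisRepresentations`; namespace `Literature.NumberTheory.GaloisRepresentations.HeckeCharacter` (home of ★ `galConj`,
`localComponent`, `localUnits`).  KERNEL ONLY: theorems; no definition, no named fact, no `sorry`.  Cell `hodgecm-mathlib` (D-0151), programme P5
(crux HLiu418 = stmt-HodgeConjecture-24832), piece **H** of the road card `F0/P5/A-p18/g23/ROAD-L4if-v2.A-p18g23.md` §4 (A-p18 (g23), 2026-08-31): the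
discharge of the hypothesis `hχχ′` of ★ `localSplittingDatumCM_comp_localPiGalConj_eq_scaleTransportSection` (p835306) ∕ ★
`localSplittingCMWith_comp_localPiGalConj_eq_scaleTransportSection` for the conjugate character `χ′ = χ ∘ σ`.

THE MATHEMATICS ([CasselsFrohlichANT1967, Ch. VII §1.1]: `Gal(L/K)` permutes the local idèles, `σ • ⟨u⟩_w = ⟨σ_w u⟩_{σw}`, ★ `algEquiv_smul_localUnits`;
[TateThesis1967, §4.3]: local components of a quasi-character).
* `localComponent_galConj_apply`: `(χ ∘ σ)_w(u) = χ_{σw}(σ_w u)`; as homomorphisms `(χ ∘ σ)_w = χ_{w′} ∘ σ_w` for `σ • w = w′` (`localComponent_galConj_eq_comp`),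
  and for the inverses `((χ ∘ σ)_w)⁻¹ = (χ_{w′})⁻¹ ∘ σ_w` (`localComponent_galConj_inv_eq_comp`) — at a place FIXED by `σ` this is literally the hypothesis
  `hχχ′` of the P1 files (`localComponent_galConj_inv_eq_comp_of_smul_eq`).
* the class-character bridge (★ `IdeleClassGroup.toHeckeCharacter_galConj`): the same for `toHeckeCharacter L (IdeleClassGroup.galConj σ ψ)`.
Nothing of the cited sources is asserted; HC_CM is proved only modulo the printed citations until rung 0 closes.

## References
* [CasselsFrohlichANT1967] J. W. S. Cassels, A. Fröhlich (eds.), Algebraic Number Theory (1967), Ch. VII §1.1.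
* [TateThesis1967] J. Tate, Fourier analysis in number fields and Hecke's zeta-functions (1950/1967), §4.3.
* [Liu2021] Y. Liu, Invent. Math. 228 (2022), §4.1 (l. 1912).
-/

set_option autoImplicit false

noncomputable section

open NumberField IsDedekindDomain
open Literature.NumberTheory.Automorphic

namespace Literature.NumberTheory.GaloisRepresentations.HeckeCharacter

variable {K : Type} [Field K] {L : Type} [Field L] [NumberField L] [Algebra K L]

/-- the unit-group transport `galAdicCompletionUnitsEquiv σ h` is `Units.map` of the ring map `galAdicCompletionMap σ h`. [folklore] -/
private theorem galAdicCompletionUnitsEquiv_eq_units_map (σ : L ≃ₐ[K] L) {w w' : HeightOneSpectrum (𝓞 L)} (h : σ • w = w')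
    (u : (w.adicCompletion L)ˣ) :
    galAdicCompletionUnitsEquiv (L := L) σ h u =
      Units.map (galAdicCompletionMap (L := L) σ h : w.adicCompletion L →* w'.adicCompletion L) u :=
  Units.ext rfl

/-- **`(χ ∘ σ)_w(u) = χ_{w′}(σ_w u)`** for `σ • w = w′`: the local component of the Galois conjugate at `w` is the local component at `σw` precomposed
with `σ_w : L_wˣ → L_{σw}ˣ` (`(χ ∘ σ)(⟨u⟩_w) = χ(σ • ⟨u⟩_w) = χ(⟨σ_w u⟩_{σw})`). [cite: CasselsFrohlichANT1967, Ch. VII §1.1] [cite: TateThesis1967, §4.3] -/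
theorem localComponent_galConj_apply (σ : L ≃ₐ[K] L) (χ : HeckeCharacter L) {w w' : HeightOneSpectrum (𝓞 L)} (h : σ • w = w')
    (u : (w.adicCompletion L)ˣ) :
    (galConj σ χ).localComponent w u =
      χ.localComponent w' (Units.map (galAdicCompletionMap (L := L) σ h : w.adicCompletion L →* w'.adicCompletion L) u) := by
  subst h
  rw [localComponent_apply, galConj_apply, algEquiv_smul_localUnits, localComponent_apply, galAdicCompletionUnitsEquiv_eq_units_map]

/-- as homomorphisms: `(χ ∘ σ)_w = χ_{w′} ∘ σ_w`. [cite: CasselsFrohlichANT1967, Ch. VII §1.1] [cite: TateThesis1967, §4.3] -/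
theorem localComponent_galConj_eq_comp (σ : L ≃ₐ[K] L) (χ : HeckeCharacter L) {w w' : HeightOneSpectrum (𝓞 L)} (h : σ • w = w') :
    (galConj σ χ).localComponent w =
      (χ.localComponent w').comp (Units.map (galAdicCompletionMap (L := L) σ h : w.adicCompletion L →* w'.adicCompletion L)) :=
  MonoidHom.ext fun u => localComponent_galConj_apply σ χ h u

/-- the inverses: `((χ ∘ σ)_w)⁻¹ = (χ_{w′})⁻¹ ∘ σ_w`. [cite: CasselsFrohlichANT1967, Ch. VII §1.1] [cite: TateThesis1967, §4.3] -/
theorem localComponent_galConj_inv_eq_comp (σ : L ≃ₐ[K] L) (χ : HeckeCharacter L) {w w' : HeightOneSpectrum (𝓞 L)} (h : σ • w = w') :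
    ((galConj σ χ).localComponent w)⁻¹ =
      (χ.localComponent w')⁻¹.comp (Units.map (galAdicCompletionMap (L := L) σ h : w.adicCompletion L →* w'.adicCompletion L)) := by
  rw [localComponent_galConj_eq_comp σ χ h]
  rfl

/-- **at a place fixed by `σ`**: `((χ ∘ σ)_w)⁻¹ = (χ_w)⁻¹ ∘ σ_w` — the hypothesis `hχχ′` of ★ `localSplittingDatumCM_comp_localPiGalConj_eq_scaleTransportSection`
for `χ′ = χ ∘ σ` at the places over a non-split `v`. [cite: CasselsFrohlichANT1967, Ch. VII §1.1] [cite: TateThesis1967, §4.3] -/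
theorem localComponent_galConj_inv_eq_comp_of_smul_eq (σ : L ≃ₐ[K] L) (χ : HeckeCharacter L) {w : HeightOneSpectrum (𝓞 L)} (h : σ • w = w) :
    ((galConj σ χ).localComponent w)⁻¹ =
      (χ.localComponent w)⁻¹.comp (Units.map (galAdicCompletionMap (L := L) σ h : w.adicCompletion L →* w.adicCompletion L)) :=
  localComponent_galConj_inv_eq_comp σ χ h

/-- **the class-character form**: for a unitary idèle class character `ψ`, the Hecke character of `ψ ∘ σ` (★ `IdeleClassGroup.galConj`) has local components
`(ψ ∘ σ)_w = ψ_{w′} ∘ σ_w`. [cite: Liu2021, §4.1 (l. 1912)] [cite: CasselsFrohlichANT1967, Ch. VII §1.1] -/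
theorem localComponent_toHeckeCharacter_galConj_eq_comp (σ : L ≃ₐ[K] L) (ψ : IdeleClassGroup L →ₜ* Circle) {w w' : HeightOneSpectrum (𝓞 L)}
    (h : σ • w = w') :
    (IdeleClassGroup.toHeckeCharacter L (IdeleClassGroup.galConj σ ψ)).localComponent w =
      ((IdeleClassGroup.toHeckeCharacter L ψ).localComponent w').comp
        (Units.map (galAdicCompletionMap (L := L) σ h : w.adicCompletion L →* w'.adicCompletion L)) := by
  rw [IdeleClassGroup.toHeckeCharacter_galConj]
  exact localComponent_galConj_eq_comp σ _ h

/-- the class-character form of the inverse identity at a place fixed by `σ`. [cite: Liu2021, §4.1 (l. 1912)] [cite: CasselsFrohlichANT1967, Ch. VII §1.1] -/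
theorem localComponent_toHeckeCharacter_galConj_inv_eq_comp_of_smul_eq (σ : L ≃ₐ[K] L) (ψ : IdeleClassGroup L →ₜ* Circle)
    {w : HeightOneSpectrum (𝓞 L)} (h : σ • w = w) :
    ((IdeleClassGroup.toHeckeCharacter L (IdeleClassGroup.galConj σ ψ)).localComponent w)⁻¹ =
      ((IdeleClassGroup.toHeckeCharacter L ψ).localComponent w)⁻¹.comp
        (Units.map (galAdicCompletionMap (L := L) σ h : w.adicCompletion L →* w.adicCompletion L)) := by
  rw [IdeleClassGroup.toHeckeCharacter_galConj]
  exact localComponent_galConj_inv_eq_comp σ _ h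

end Literature.NumberTheory.GaloisRepresentations.HeckeCharacter

end
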